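import Summits.BirchSwinnertonDyer.BirchSwinnertonDyer.Theorems.ClassRecordThreeEulerHalvesAtThreeCartanSupplyCosetsTrace
import Summits.BirchSwinnertonDyer.BirchSwinnertonDyer.Theorems.ClassRecordThreeEulerHalvesAtThreeCartanTorusCubeCutCuspDiagCount
import HarnessLib

/-!
# SUPPLY from PERMUTATION MODELS, VI — the two TORUS LINES come for free from the TRACE IDENTITY

Helper file riding `--supports stmt-BirchSwinnertonDyer-19109` (crux `EulerHalvesAtThree`; UNREGISTERED sub-line `Cruxes/EulerHalvesAtThree/Lines/cartan_corr`,
seat `bsd-idea-10` g12), continuing `…CartanSupplyPermModel ∕ PermSubmodule ∕ IsotypicKernel ∕ Cosets ∕ CosetsTrace`. RANK BY TRACE (`exists_generator_of_trace`): for a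
subgroup `T₀` acting on the stable lattice `K = ker A ⊂ ℤ^n` with the trace identity `tr(t | K) = χ(t)`, the averaging map `Q = Σ_{t ∈ T₀} t : K → F`, `F = K^{T₀}` the fixed
sublattice, satisfies `ι ∘ Q = Σ_t t|_K` and `Q ∘ ι = |T₀|·id_F`; taking traces (`LinearMap.trace_comp_comm'`), `Σ_{t ∈ T₀} χ(t) = |T₀|·rank F`. So the tree's TORUS SUMS
`Σ_{T} χ_W = |T|` (cartan-f2a: `PS.sum_char_splitTorus`, `PS.sum_char_nonsplitTorus`, cusp `sum_char_nonsplitTorus`; the cusp split-torus sum `sum_char_splitTorus_cusp` is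
proved here) give `rank F = 1`, i.e. BOTH TORUS LINES WITH GENERATORS, and an elliptic `η` exists for `q ≠ 2` (`exists_not_hasRatEigenvalue`, from
`FiniteField.exists_nonsquare`). NET: `CartanTraceIdentitySupply` — per prime `q ∉ {2,3}` NOTHING BUT the trace identity `tr(g | ker A_{χ_W}) = χ_W(g)` on `ℤ[G ∕ T]`
(`T = T_s` for `q ≡ 1 (3)`; `T = C(η)` for SOME elliptic `η` for `q ≡ 2 (3)`) — and `cartanTorusLatticeSupply_of_traceIdentitySupply : CartanTraceIdentitySupply →
CartanTorusLatticeSupply` (SUPPLY, the v11 stub of 23422's line `cartan`, BY NAME; `q = 2` by the LEAD's `CartanSignLatticeTwo.cartanTorusLatticeSupply_two`).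
HONEST FRAMING: reductions and linear algebra; the trace identity («`W_q` occurs once in `ℚ[G ∕ T]`», Mackey) is NOT proved; SUPPLY ∕ NUM ∕ (F2b♭) ∕ the cruxes are NOT
proved; BSD is proved for no curve. [folklore]
-/

set_option linter.dupNamespace false
set_option autoImplicit false

namespace Summit.BirchSwinnertonDyer.BirchSwinnertonDyer.Theorems.CartanSupply

open Summit.BirchSwinnertonDyer.BirchSwinnertonDyer.Theorems.CartanDegree
open Summit.BirchSwinnertonDyer.BirchSwinnertonDyer.Theorems.CartanTorusCubeCut
open Summit.BirchSwinnertonDyer.BirchSwinnertonDyer.Theorems.CartanCorrespondence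
open scoped Classical

/-! ## §1 Rank by trace: the fixed sublattice of a subgroup is a line -/

section fixedline
variable {G : Type*} [Group G] [Fintype G] {n : ℕ} (σ : G →* Equiv.Perm (Fin n))

/-- The sublattice of `ker A_χ` fixed pointwise by the subgroup `T₀`. -/
def fixedKer (χ : G → ℤ) (T₀ : Subgroup G) : Submodule ℤ (Fin n → ℤ) where
  carrier := {φ | isotypicOp σ χ φ = 0 ∧ ∀ t ∈ T₀, permAct σ t φ = φ}
  add_mem' := by
    rintro a b ⟨ha, ha'⟩ ⟨hb, hb'⟩
    exact ⟨by rw [map_add, ha, hb, add_zero], fun t ht => by rw [map_add, ha' t ht, hb' t ht]⟩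
  zero_mem' := ⟨map_zero _, fun t _ => map_zero _⟩
  smul_mem' := by
    rintro c a ⟨ha, ha'⟩
    exact ⟨by rw [map_smul, ha, smul_zero], fun t ht => by rw [map_smul, ha' t ht]⟩

/-- PROVED — RANK BY TRACE: if `Σ_{t ∈ T₀} χ(t) = |T₀|` and `tr(t | ker A_χ) = χ(t)`, the `T₀`-fixed sublattice of `ker A_χ` is a LINE with a generator. [folklore] -/
theorem exists_generator_of_trace (χ : G → ℤ) (T₀ : Subgroup G)
    (hst : ∀ g, ∀ φ ∈ LinearMap.ker (isotypicOp σ χ), permAct σ g φ ∈ LinearMap.ker (isotypicOp σ χ))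
    (htr : ∀ g, LinearMap.trace ℤ (LinearMap.ker (isotypicOp σ χ)) ((permAct σ g).restrict (hst g)) = χ g)
    (hsum : ∑ t : T₀, χ t = Nat.card T₀) :
    ∃ φ₀ : Fin n → ℤ, φ₀ ∈ fixedKer σ χ T₀ ∧ φ₀ ≠ 0 ∧ ∀ φ ∈ fixedKer σ χ T₀, ∃ m : ℤ, φ = m • φ₀ := by
  have hFK : fixedKer σ χ T₀ ≤ LinearMap.ker (isotypicOp σ χ) := fun φ hφ => LinearMap.mem_ker.mpr hφ.1
  obtain ⟨dK, bK⟩ := Submodule.basisOfPid (Pi.basisFun ℤ (Fin n)) (LinearMap.ker (isotypicOp σ χ))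
  obtain ⟨dF, bF⟩ := Submodule.basisOfPid (Pi.basisFun ℤ (Fin n)) (fixedKer σ χ T₀)
  haveI := Module.Free.of_basis bK
  haveI := Module.Finite.of_basis bK
  haveI := Module.Free.of_basis bF
  haveI := Module.Finite.of_basis bF
  -- the averaging map `Q : K → F`
  have hmul : ∀ (t s : G) (φ : Fin n → ℤ), permAct σ t (permAct σ s φ) = permAct σ (t * s) φ :=
    fun t s φ => by rw [map_mul, Module.End.mul_apply]
  have hQmem : ∀ x : LinearMap.ker (isotypicOp σ χ), (∑ t : T₀, permAct σ (t : G) (x : Fin n → ℤ)) ∈ fixedKer σ χ T₀ := by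
    intro x
    refine ⟨?_, ?_⟩
    · exact LinearMap.mem_ker.mp (Submodule.sum_mem _ (fun t _ => hst _ _ x.2))
    · intro t ht
      rw [map_sum]
      simp only [hmul]
      exact Fintype.sum_equiv (Equiv.mulLeft (⟨t, ht⟩ : T₀)) _ _ (fun s => rfl)
  let Q : LinearMap.ker (isotypicOp σ χ) →ₗ[ℤ] fixedKer σ χ T₀ :=
    { toFun := fun x => ⟨∑ t : T₀, permAct σ (t : G) (x : Fin n → ℤ), hQmem x⟩
      map_add' := by
        intro x y
        apply Subtype.ext
        simp only [Submodule.coe_add, map_add, Finset.sum_add_distrib]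
      map_smul' := by
        intro c x
        apply Subtype.ext
        simp only [Submodule.coe_smul, map_smul, Finset.smul_sum, RingHom.id_apply] }
  let ι : fixedKer σ χ T₀ →ₗ[ℤ] LinearMap.ker (isotypicOp σ χ) := Submodule.inclusion hFK
  -- (1) `ι ∘ Q = Σ_t t|_K`
  have h1 : ι ∘ₗ Q = ∑ t : T₀, (permAct σ (t : G)).restrict (hst t) := by
    apply LinearMap.ext
    intro x
    apply Subtype.ext
    rw [LinearMap.sum_apply, Submodule.coe_sum]
    simp only [LinearMap.coe_restrict_apply]
    rfl
  -- (2) its trace is `|T₀|`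
  have h2 : LinearMap.trace ℤ (LinearMap.ker (isotypicOp σ χ)) (ι ∘ₗ Q) = Nat.card T₀ := by
    rw [h1, map_sum, ← hsum]
    exact Finset.sum_congr rfl (fun t _ => htr t)
  -- (3) `Q ∘ ι = |T₀| • id`
  have h3 : Q ∘ₗ ι = (Nat.card T₀ : ℤ) • LinearMap.id := by
    apply LinearMap.ext
    intro y
    apply Subtype.ext
    have hy : ∀ t : T₀, permAct σ (t : G) (y : Fin n → ℤ) = y := fun t => y.2.2 t t.2
    show (∑ t : T₀, permAct σ (t : G) (y : Fin n → ℤ)) = ((Nat.card T₀ : ℤ) • y : fixedKer σ χ T₀)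
    simp only [hy, Finset.sum_const, Finset.card_univ, Submodule.coe_smul, Nat.card_eq_fintype_card]
    rw [← natCast_zsmul]
  -- (4) `|T₀| = |T₀| · rank F`
  have h4 : (Nat.card T₀ : ℤ) * 1 = (Nat.card T₀ : ℤ) * Module.finrank ℤ (fixedKer σ χ T₀) := by
    have h := LinearMap.trace_comp_comm' Q ι
    rw [h2, h3, map_smul, LinearMap.trace_id, smul_eq_mul] at h
    rw [mul_one]
    exact h
  have hT : (Nat.card T₀ : ℤ) ≠ 0 := by exact_mod_cast Nat.card_pos.ne'
  have hrank : Module.finrank ℤ (fixedKer σ χ T₀) = 1 := by exact_mod_cast (mul_left_cancel₀ hT h4).symm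
  -- (5) a basis of `F` has one element: it is the generator
  have hdF : dF = 1 := by
    have h := Module.finrank_eq_card_basis bF
    rw [hrank, Fintype.card_fin] at h
    exact h.symm
  subst hdF
  refine ⟨(bF 0 : fixedKer σ χ T₀), (bF 0).2, fun h0 => bF.ne_zero 0 (Subtype.ext h0), ?_⟩
  intro φ hφ
  refine ⟨bF.repr ⟨φ, hφ⟩ 0, ?_⟩
  have h := bF.sum_repr ⟨φ, hφ⟩
  rw [Fin.sum_univ_one] at h
  have h' := congrArg Subtype.val h
  rw [Submodule.coe_smul] at h'
  exact h'.symm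

end fixedline

/-! ## §2 `GL₂(𝔽_q)`: an elliptic `η` exists; the split-torus sum at cuspidal primes; torus sums over the torus subgroups -/

variable {q : ℕ} [Fact q.Prime]

/-- PROVED: for `q ≠ 2` there is a matrix without rational eigenvalue (`[[0, a], [1, 0]]`, `a` a non-square). [folklore] -/
theorem exists_not_hasRatEigenvalue (hq2 : q ≠ 2) : ∃ η : Mat q, ¬ HasRatEigenvalue η := by
  have hchar : ringChar (ZMod q) ≠ 2 := by rw [ZMod.ringChar_zmod_n]; exact hq2
  obtain ⟨a, ha⟩ := FiniteField.exists_nonsquare hchar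
  refine ⟨!![0, a; 1, 0], ?_⟩
  rintro ⟨x, hx⟩
  rw [Matrix.det_fin_two, Matrix.trace_fin_two] at hx
  simp only [Matrix.of_apply, Matrix.cons_val', Matrix.cons_val_zero, Matrix.cons_val_one, Matrix.cons_val_fin_one,
    Matrix.empty_val'] at hx
  apply ha
  exact ⟨x, by linear_combination -hx⟩

/-- PROVED: at `q ≢ 1 (mod 3)` the character vanishes on the non-scalar split torus and is `q − 1` on scalars, so `Σ_{T_s} χ_W = (q−1)²`. [folklore] -/
theorem sum_char_splitTorus_cusp (h2 : q % 3 ≠ 1) :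
    ∑ t ∈ splitTorus q, cubicNewvectorChar q t = ((q - 1 : ℕ) : ℤ) * ((q : ℤ) - 1) := by
  classical
  have hval : ∀ t ∈ splitTorus q, cubicNewvectorChar q t = if IsScalarMat (t : Mat q) then (q : ℤ) - 1 else 0 := by
    intro t ht
    have ht' : (t : Mat q) 0 1 = 0 ∧ (t : Mat q) 1 0 = 0 := by simpa [splitTorus] using ht
    by_cases hsc : IsScalarMat (t : Mat q)
    · rw [if_pos hsc]
      unfold cubicNewvectorChar
      rw [PS.charMat_of_isScalar hsc, if_neg h2]
    · rw [if_neg hsc]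
      have hne : (t : Mat q) 0 0 ≠ (t : Mat q) 1 1 := fun h => hsc ⟨ht'.1, ht'.2, h⟩
      have hΔ : (t : Mat q).trace ^ 2 - 4 * (t : Mat q).det ≠ 0 := by
        rw [Matrix.trace_fin_two, Matrix.det_fin_two, ht'.1, zero_mul, sub_zero]
        have : ((t : Mat q) 0 0 + (t : Mat q) 1 1) ^ 2 - 4 * ((t : Mat q) 0 0 * (t : Mat q) 1 1) =
            ((t : Mat q) 0 0 - (t : Mat q) 1 1) ^ 2 := by ring
        rw [this]
        exact pow_ne_zero 2 (sub_ne_zero.mpr hne)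
      have hrat : HasRatEigenvalue (t : Mat q) :=
        ⟨(t : Mat q) 0 0, by rw [Matrix.trace_fin_two, Matrix.det_fin_two, ht'.1, zero_mul, sub_zero]; ring⟩
      unfold cubicNewvectorChar cubicNewvectorCharMat
      simp only [if_neg h2, if_neg hΔ, if_pos hrat]
  rw [Finset.sum_congr rfl hval, Finset.sum_ite, Finset.sum_const_zero, add_zero, Finset.sum_const, card_scalar_splitTorus,
    nsmul_eq_mul]

/-- PROVED: the sum over the split torus as a subgroup. [folklore] -/
theorem sum_subtype_splitTorusSub (f : G q → ℤ) : ∑ t : splitTorusSub q, f t = ∑ t ∈ splitTorus q, f t := by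
  have h : ∀ g : G q, g ∈ splitTorus q ↔ g ∈ splitTorusSub q := by
    intro g
    show g ∈ splitTorus q ↔ (g : Mat q) 0 1 = 0 ∧ (g : Mat q) 1 0 = 0
    simp [splitTorus]
  exact (Finset.sum_subtype (splitTorus q) h f).symm

/-- PROVED: the sum over the non-split torus as a subgroup. [folklore] -/
theorem sum_subtype_centralizerSub (η : Mat q) (f : G q → ℤ) : ∑ t : centralizerSub η, f t = ∑ t ∈ nonsplitTorus η, f t := by
  have h : ∀ g : G q, g ∈ nonsplitTorus η ↔ g ∈ centralizerSub η := by
    intro g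
    show g ∈ nonsplitTorus η ↔ (g : Mat q) * η = η * g
    simp [nonsplitTorus]
  exact (Finset.sum_subtype (nonsplitTorus η) h f).symm

/-- PROVED: `Σ_{t ∈ T_s} χ_W(t) = |T_s|` for every prime `q`. [folklore] -/
theorem sum_char_splitTorusSub : ∑ t : splitTorusSub q, cubicNewvectorChar q t = Nat.card (splitTorusSub q) := by
  rw [sum_subtype_splitTorusSub, card_splitTorusSub]
  have hq : 1 ≤ q := (Fact.out : q.Prime).one_lt.le
  have hs : ∑ t ∈ splitTorus q, cubicNewvectorChar q t = ((q - 1 : ℕ) : ℤ) * ((q : ℤ) - 1) := by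
    by_cases h1 : q % 3 = 1
    · exact PS.sum_char_splitTorus h1
    · exact sum_char_splitTorus_cusp h1
  rw [hs, Nat.cast_pow, Nat.cast_sub hq, Nat.cast_one]
  ring

/-- PROVED: `Σ_{t ∈ C(η)} χ_W(t) = |C(η)|` for every prime `q ≠ 3` and elliptic `η`. [folklore] -/
theorem sum_char_centralizerSub (hq2 : q ≠ 2) (h3 : q ≠ 3) {η : Mat q} (hη : ¬ HasRatEigenvalue η) :
    ∑ t : centralizerSub η, cubicNewvectorChar q t = Nat.card (centralizerSub η) := by
  rw [sum_subtype_centralizerSub, card_centralizerSub hη]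
  have hq2' : 2 ≤ q := (Fact.out : q.Prime).two_le
  have hq : 1 ≤ q := by omega
  rcases prime_mod_three (Fact.out : q.Prime) h3 with h1 | h2
  · rw [PS.sum_char_nonsplitTorus h1 hη, Nat.cast_mul, Nat.cast_sub hq, Nat.cast_add, Nat.cast_one]
  · have hq5 : 5 ≤ q := by omega
    rw [sum_char_nonsplitTorus hη hq5 h2, nonsplitTorus_card hη]

/-! ## §3 The trace identity alone supplies the Cartan torus lattice -/

/-- PROVED — one prime at a time, `q ≡ 1 (mod 3)`: the trace identity on `ker A_{χ_W} ⊂ ℤ[G ∕ T_s]` supplies the lattice. [folklore] -/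
theorem cartanTorusLatticeSupplyAt_of_splitTraceIdentity (h1 : q % 3 = 1)
    (htr : ∀ g, LinearMap.trace ℤ (LinearMap.ker (isotypicOp (cosetPerm (splitTorusSub q)) (cubicNewvectorChar q)))
      ((permAct (cosetPerm (splitTorusSub q)) g).restrict (ker_isotypicOp_stable (cosetPerm (splitTorusSub q)) g)) = cubicNewvectorChar q g) :
    ∃ (𝓛 : CartanTorusLattice q) (wS wC : Fin 𝓛.d → ℤ),
      𝓛.IsSplitFixed wS ∧ 𝓛.IsNonsplitFixed wC ∧
      (∀ v, 𝓛.IsSplitFixed v → ∃ m : ℤ, v = m • wS) ∧ (∀ v, 𝓛.IsNonsplitFixed v → ∃ m : ℤ, v = m • wC) ∧ wS ≠ 0 ∧ wC ≠ 0 := by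
  have hq2 : q ≠ 2 := by intro h; subst h; norm_num at h1
  have h3 : q ≠ 3 := by intro h; subst h; norm_num at h1
  obtain ⟨η, hη⟩ := exists_not_hasRatEigenvalue hq2
  obtain ⟨φS, hSmem, hSne, hSgen⟩ := exists_generator_of_trace (cosetPerm (splitTorusSub q)) (cubicNewvectorChar q) (splitTorusSub q)
    (ker_isotypicOp_stable _) htr sum_char_splitTorusSub
  obtain ⟨φC, hCmem, hCne, hCgen⟩ := exists_generator_of_trace (cosetPerm (splitTorusSub q)) (cubicNewvectorChar q) (centralizerSub η)
    (ker_isotypicOp_stable _) htr (sum_char_centralizerSub hq2 h3 hη)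
  exact cartanTorusLatticeSupplyAt_of_splitCosetTrace hq2
    { mod_three := h1, trace_eq := htr, η := η, η_irred := hη, φS := φS, φC := φC, φS_mem := hSmem.1, φC_mem := hCmem.1,
      φS_fixed := fun g h01 h10 => hSmem.2 g (show (g : Mat q) 0 1 = 0 ∧ (g : Mat q) 1 0 = 0 from ⟨h01, h10⟩),
      φC_fixed := fun g hg => hCmem.2 g (show (g : Mat q) * η = η * g from hg),
      φS_gen := fun φ hA hfix => hSgen φ ⟨hA, fun t ht => hfix t ht.1 ht.2⟩,
      φC_gen := fun φ hA hfix => hCgen φ ⟨hA, fun t ht => hfix t ht⟩,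
      φS_ne := hSne, φC_ne := hCne }

/-- PROVED — one prime at a time, `q ≡ 2 (mod 3)`, `q ≠ 2`: the trace identity on `ker A_{χ_W} ⊂ ℤ[G ∕ C(η)]` supplies the lattice. [folklore] -/
theorem cartanTorusLatticeSupplyAt_of_nonsplitTraceIdentity (hq2 : q ≠ 2) (h2 : q % 3 = 2) {η : Mat q} (hη : ¬ HasRatEigenvalue η)
    (htr : ∀ g, LinearMap.trace ℤ (LinearMap.ker (isotypicOp (cosetPerm (centralizerSub η)) (cubicNewvectorChar q)))
      ((permAct (cosetPerm (centralizerSub η)) g).restrict (ker_isotypicOp_stable (cosetPerm (centralizerSub η)) g)) = cubicNewvectorChar q g) :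
    ∃ (𝓛 : CartanTorusLattice q) (wS wC : Fin 𝓛.d → ℤ),
      𝓛.IsSplitFixed wS ∧ 𝓛.IsNonsplitFixed wC ∧
      (∀ v, 𝓛.IsSplitFixed v → ∃ m : ℤ, v = m • wS) ∧ (∀ v, 𝓛.IsNonsplitFixed v → ∃ m : ℤ, v = m • wC) ∧ wS ≠ 0 ∧ wC ≠ 0 := by
  have h3 : q ≠ 3 := by intro h; subst h; norm_num at h2
  obtain ⟨φS, hSmem, hSne, hSgen⟩ := exists_generator_of_trace (cosetPerm (centralizerSub η)) (cubicNewvectorChar q) (splitTorusSub q)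
    (ker_isotypicOp_stable _) htr sum_char_splitTorusSub
  obtain ⟨φC, hCmem, hCne, hCgen⟩ := exists_generator_of_trace (cosetPerm (centralizerSub η)) (cubicNewvectorChar q) (centralizerSub η)
    (ker_isotypicOp_stable _) htr (sum_char_centralizerSub hq2 h3 hη)
  exact cartanTorusLatticeSupplyAt_of_nonsplitCosetTrace hq2
    { mod_three := h2, η := η, η_irred := hη, trace_eq := htr, φS := φS, φC := φC, φS_mem := hSmem.1, φC_mem := hCmem.1,
      φS_fixed := fun g h01 h10 => hSmem.2 g (show (g : Mat q) 0 1 = 0 ∧ (g : Mat q) 1 0 = 0 from ⟨h01, h10⟩),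
      φC_fixed := fun g hg => hCmem.2 g (show (g : Mat q) * η = η * g from hg),
      φS_gen := fun φ hA hfix => hSgen φ ⟨hA, fun t ht => hfix t ht.1 ht.2⟩,
      φC_gen := fun φ hA hfix => hCgen φ ⟨hA, fun t ht => hfix t ht⟩,
      φS_ne := hSne, φC_ne := hCne }

/-- **TRACE IDENTITY SUPPLY**: per prime `q ∉ {2, 3}`, the trace identity `tr(g | ker A_{χ_W}) = χ_W(g)` on `ℤ[G ∕ T]` — `T = T_s` (`q ≡ 1 (3)`), `T = C(η)` for some
elliptic `η` (`q ≡ 2 (3)`) — i.e. «`W_q` occurs exactly once in `ℚ[G ∕ T]` and `ker A` is its isotypic lattice». Nothing else. [folklore] -/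
@[conjecture]
def CartanTraceIdentitySupply : Prop := ∀ q : ℕ, ∀ _hq : Fact q.Prime, q ≠ 3 → q ≠ 2 →
  (q % 3 = 1 → ∀ g, LinearMap.trace ℤ (LinearMap.ker (isotypicOp (cosetPerm (splitTorusSub q)) (cubicNewvectorChar q)))
      ((permAct (cosetPerm (splitTorusSub q)) g).restrict (ker_isotypicOp_stable (cosetPerm (splitTorusSub q)) g)) = cubicNewvectorChar q g) ∧
  (q % 3 = 2 → ∃ η : Mat q, ¬ HasRatEigenvalue η ∧
    ∀ g, LinearMap.trace ℤ (LinearMap.ker (isotypicOp (cosetPerm (centralizerSub η)) (cubicNewvectorChar q)))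
      ((permAct (cosetPerm (centralizerSub η)) g).restrict (ker_isotypicOp_stable (cosetPerm (centralizerSub η)) g)) = cubicNewvectorChar q g)

omit [Fact q.Prime] in
/-- PROVED — **SUPPLY ⟸ TRACE IDENTITY SUPPLY** (`CartanTorusLatticeSupply` BY NAME; the place `2` is `CartanSignLatticeTwo.cartanTorusLatticeSupply_two`). [folklore] -/
theorem cartanTorusLatticeSupply_of_traceIdentitySupply (h : CartanTraceIdentitySupply) : CartanTorusLatticeSupply := by
  intro q hq h3
  haveI : Fact q.Prime := ⟨hq⟩
  by_cases hq2 : q = 2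
  · subst hq2
    exact CartanSignLatticeTwo.cartanTorusLatticeSupply_two
  rcases prime_mod_three hq h3 with h1 | h2
  · exact cartanTorusLatticeSupplyAt_of_splitTraceIdentity h1 ((h q ⟨hq⟩ h3 hq2).1 h1)
  · obtain ⟨η, hη, htr⟩ := (h q ⟨hq⟩ h3 hq2).2 h2
    exact cartanTorusLatticeSupplyAt_of_nonsplitTraceIdentity hq2 h2 hη htr

end Summit.BirchSwinnertonDyer.BirchSwinnertonDyer.Theorems.CartanSupply
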